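import Summits.CriticalPhenomena.PercolationContinuityZ3.Theorems.PercNearOneGluingNoHeavyLowerTailQ44bPencilTools
import HarnessLib

/-!
# `Q44b` pencil at `a`: the concavity gap and its BASE CASE (frozen cluster with a single exit)

Support file for crux `stmt-CriticalPhenomena-4575` (master-family programme, quadratic four-point row `Q44b` of
`prim-bnk-1` gen 13, OPEN for all `n`), seat `prim-l12-p6` gen 8; memo
`run/shared/lean/prim/prim-l12/FROM-prim-l12-p6-g8-Q44B-MIXED-BERNSTEIN.md` §3–§4.  Companion of
`…Q44bStripping.lean` (the induction), which reduces gen 7's pencil-concavity hypothesis `ND_a`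
(`Q44b.row_nonneg_of_pencilConcave`) to one second-order inequality `TC₁`.

* `Q44b.ndGap` — the concavity gap `B₀₁ + B₁₀ − B₀ − B₂` of the pencil along a pair `e`
  (`pencilConcave_iff_ndGap`).
* `Q44b.ndGap_nonneg_base` — **base case of the stripping induction** (unconditional): if every pair other than
  `e = s(x,z)` at a vertex surely joined to `a` in `w[e↦0]` has weight `0` or `1`, then `0 ≤ ndGap w e`.  Either a
  terminal is surely joined to `a` (all four bilinear forms vanish, `bil_eq_zero_of_conn_one`), or `a`'s cluster is
  frozen away from `b,c,y`; then `e` is its only exit, the connectivity of `b,c,y` has the same law under `w[e↦0]`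
  and `w[e↦1]` (`…Q44bPencilTools.lean`: gluing identities + the one-exit path lemma), and the gap equals
  `P₁(AΔ)P₁(X) + P₁(AC ∧ a≁c)P₁(X′) ≥ 0`.

One definition (`ndGap`) and theorems; no named facts, no sorries, standard axioms.
-/

noncomputable section

namespace Summit.CriticalPhenomena.PercolationContinuityZ3.Theorems

namespace Q44b

open MeasureTheory Set Literature.Probability.LatticeModels Literature.Probability.Percolation
open scoped Classical

variable {n : ℕ}

/-! ### The concavity gap -/

/-- The concavity gap of the pencil along `e`: `B₀₁ + B₁₀ − B₀ − B₂` (`PencilConcave w e ↔ 0 ≤ ndGap w e`). [this work] -/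
def ndGap (w : Sym2 (Fin n) → unitInterval) (e : Sym2 (Fin n)) (a b c y : Fin n) : ℝ :=
  bil (Function.update w e 0) (Function.update w e 1) a b c y +
    bil (Function.update w e 1) (Function.update w e 0) a b c y -
    bil (Function.update w e 0) (Function.update w e 0) a b c y -
    bil (Function.update w e 1) (Function.update w e 1) a b c y

/-- `PencilConcave` is nonnegativity of the gap. [this work] -/
theorem pencilConcave_iff_ndGap (w : Sym2 (Fin n) → unitInterval) (e : Sym2 (Fin n)) (a b c y : Fin n) :
    PencilConcave w e a b c y ↔ 0 ≤ ndGap w e a b c y := by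
  unfold PencilConcave ndGap
  constructor <;> intro h <;> linarith

/-! ### The base case: `a`'s cluster frozen except for the pencil pair -/

/-- **Base case.**  If every pair other than `e = s(x,z)` at a vertex surely joined to `a` in `w[e↦0]` has weight
`0` or `1`, then the pencil along `e` is concave: `0 ≤ ndGap w e`. [this work] -/
theorem ndGap_nonneg_base (w : Sym2 (Fin n) → unitInterval) (a b c y x z : Fin n)
    (hsure : sureJoined (Function.update w s(x, z) 0) a x)
    (hfro : ∀ x' u : Fin n, x' ≠ u → s(x', u) ≠ s(x, z) →
      sureJoined (Function.update w s(x, z) 0) a x' → (w s(x', u) = 0 ∨ w s(x', u) = 1)) :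
    0 ≤ ndGap w s(x, z) a b c y := by
  set e : Sym2 (Fin n) := s(x, z) with he
  set w0 := Function.update w e 0 with hw0
  set w1 := Function.update w e 1 with hw1
  -- under `w0` every pair at `a`'s sure cluster is `0` or `1`
  have hfro0 : ∀ x' u : Fin n, x' ≠ u → sureJoined w0 a x' → (w0 s(x', u) = 0 ∨ w0 s(x', u) = 1) := by
    intro x' u hx'u hs
    by_cases hg : s(x', u) = e
    · left; rw [hg, hw0, Function.update_self]
    · rw [hw0, Function.update_of_ne hg]
      exact hfro x' u hx'u hg hs
  have h01 := real_openConn_zero_or_one w0 a hfro0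
  -- Case (i): a terminal is surely joined to `a`
  by_cases hT : ∃ t, (t = b ∨ t = c ∨ t = y) ∧ (prodBernoulli w0).real (openConn a t) = 1
  · obtain ⟨t, ht, h1⟩ := hT
    have hst : sureJoined w0 a t := by
      by_contra hns
      have h0 : (prodBernoulli w0).real (openConn a t) = 0 := by
        rw [← measureReal_empty (μ := prodBernoulli w0)]
        refine measureReal_congr ?_
        filter_upwards [ae_reachable_iff_sureJoined w0 a hfro0 t] with ω hω
        exact propext (iff_of_false (fun h => hns (hω.1 h)) (notMem_empty ω))
      rw [h0] at h1; exact absurd h1 (by norm_num)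
    have h1' : (prodBernoulli w1).real (openConn a t) = 1 := by
      have : w1 = Function.update w0 e 1 := by rw [hw1, hw0, Function.update_idem]
      rw [this]
      exact real_openConn_eq_one_of_sureJoined _ a t (sureJoined_update_one w0 e hst)
    unfold ndGap
    rw [← hw0, ← hw1, bil_eq_zero_of_conn_one w0 w1 a b c y t ht h1 h1',
      bil_eq_zero_of_conn_one w1 w0 a b c y t ht h1' h1, bil_eq_zero_of_conn_one w0 w0 a b c y t ht h1 h1,
      bil_eq_zero_of_conn_one w1 w1 a b c y t ht h1' h1']
    simp
  -- Case (ii): `a` is almost surely separated from `b, c, y` under `w0`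
  push Not at hT
  have hb0 : (prodBernoulli w0).real (openConn a b) = 0 :=
    (h01 b).resolve_right (hT b (Or.inl rfl))
  have hc0 : (prodBernoulli w0).real (openConn a c) = 0 :=
    (h01 c).resolve_right (hT c (Or.inr (Or.inl rfl)))
  have hy0 : (prodBernoulli w0).real (openConn a y) = 0 :=
    (h01 y).resolve_right (hT y (Or.inr (Or.inr rfl)))
  -- the terminals are not surely joined to `a` under `w0`
  have nsj : ∀ t, (prodBernoulli w0).real (openConn a t) = 0 → ¬ sureJoined w0 a t := by
    intro t h0 hs
    have := real_openConn_eq_one_of_sureJoined w0 a t hs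
    rw [h0] at this; exact absurd this (by norm_num)
  -- A := the sure cluster of `a` under `w0`; every pair from `A` to its complement other than `e` has weight 0
  set A : Set (Fin n) := {v | sureJoined w0 a v} with hA
  have hxA : x ∈ A := hsure
  have hbd0 : ∀ p q : Fin n, p ∈ A → q ∉ A → s(p, q) ≠ e → w s(p, q) = 0 := by
    intro p q hp hq hpq
    have hne : p ≠ q := fun h => hq (h ▸ hp)
    rcases hfro p q hne hpq hp with h | h
    · exact h
    · exfalso
      apply hq
      have hw0pq : w0 s(p, q) = 1 := by rw [hw0, Function.update_of_ne hpq]; exact h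
      exact SimpleGraph.Reachable.trans hp
        (SimpleGraph.Adj.reachable ((SimpleGraph.fromEdgeSet_adj _).2 ⟨hw0pq, hne⟩))
  -- almost surely under `P_w`, the open boundary pairs of `A` are ⊆ {e}
  have hgood : ∀ᵐ ω ∂(prodBernoulli w), ∀ p q : Fin n, p ∈ A → q ∉ A → s(p, q) ∈ ω → s(p, q) = e := by
    have : ∀ f : Sym2 (Fin n), ∀ᵐ ω ∂(prodBernoulli w), (w f = 0 → f ∉ ω) := by
      intro f
      by_cases hf : w f = 0
      · filter_upwards [prodBernoulli_ae_notMem w hf] with ω hω using fun _ => hω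
      · exact Filter.Eventually.of_forall fun ω h => absurd h hf
    filter_upwards [ae_all_iff.2 this] with ω hω
    intro p q hp hq hmem
    by_contra hne
    exact hω _ (hbd0 p q hp hq hne) hmem
  -- hence, for terminals outside `A`, connectivity does not see the state of `e`
  have hbA : b ∉ A := nsj b hb0
  have hcA : c ∉ A := nsj c hc0
  have hyA : y ∉ A := nsj y hy0
  have reach_ae : ∀ {t t' : Fin n}, t ∉ A → t' ∉ A →
      ∀ᵐ ω ∂(prodBernoulli w), ((openGraph (insert e ω)).Reachable t t' ↔
        (openGraph (ω \ {e})).Reachable t t') := by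
    intro t t' ht ht'
    filter_upwards [hgood] with ω hω
    exact reachable_insert_iff_of_boundary A hxA ω hω ht ht'
  -- the three `{b,c,y}`-events: pairwise separation, `c~y`, `b~c ∧ b~y`
  set Sep3 : Set (BondConfig (Fin n)) := (openConn b c)ᶜ ∩ (openConn b y)ᶜ ∩ (openConn c y)ᶜ with hSep3
  set CY : Set (BondConfig (Fin n)) := openConn c y with hCY
  set BCY : Set (BondConfig (Fin n)) := openConn b c ∩ openConn b y with hBCY
  have eqSep : (prodBernoulli w1).real Sep3 = (prodBernoulli w0).real Sep3 := by
    apply real_update_one_eq_zero_of_ae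
    filter_upwards [reach_ae hbA hcA, reach_ae hbA hyA, reach_ae hcA hyA] with ω h1 h2 h3
    rw [hSep3]
    exact ⟨fun hh => ⟨⟨fun r => hh.1.1 (h1.2 r), fun r => hh.1.2 (h2.2 r)⟩, fun r => hh.2 (h3.2 r)⟩,
      fun hh => ⟨⟨fun r => hh.1.1 (h1.1 r), fun r => hh.1.2 (h2.1 r)⟩, fun r => hh.2 (h3.1 r)⟩⟩
  have eqCY : (prodBernoulli w1).real CY = (prodBernoulli w0).real CY := by
    apply real_update_one_eq_zero_of_ae
    filter_upwards [reach_ae hcA hyA] with ω h3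
    rw [hCY]
    exact h3
  have eqBCY : (prodBernoulli w1).real BCY = (prodBernoulli w0).real BCY := by
    apply real_update_one_eq_zero_of_ae
    filter_upwards [reach_ae hbA hcA, reach_ae hbA hyA] with ω h1 h2
    rw [hBCY]
    exact ⟨fun hh => ⟨h1.1 hh.1, h2.1 hh.2⟩, fun hh => ⟨h1.2 hh.1, h2.2 hh.2⟩⟩
  -- complements of the null events `{a~t}` under `w0`
  have cb : ∀ᵐ ω ∂(prodBernoulli w0), ω ∉ openConn a b :=
    measure_eq_zero_iff_ae_notMem.1 ((measureReal_eq_zero_iff (measure_ne_top _ _)).1 hb0)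
  have cc : ∀ᵐ ω ∂(prodBernoulli w0), ω ∉ openConn a c :=
    measure_eq_zero_iff_ae_notMem.1 ((measureReal_eq_zero_iff (measure_ne_top _ _)).1 hc0)
  have cy' : ∀ᵐ ω ∂(prodBernoulli w0), ω ∉ openConn a y :=
    measure_eq_zero_iff_ae_notMem.1 ((measureReal_eq_zero_iff (measure_ne_top _ _)).1 hy0)
  -- under `w0`: the row events reduce to `{b,c,y}`-events
  have p0Emp : (prodBernoulli w0).real (evEmp a b c y) = (prodBernoulli w0).real Sep3 := by
    refine measureReal_congr ?_
    filter_upwards [cb, cc, cy'] with ω h1 h2 h3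
    rw [hSep3]
    exact propext ⟨fun hh => ⟨⟨hh.1.1.2, hh.1.2⟩, hh.2⟩, fun hh => ⟨⟨⟨⟨⟨h1, h2⟩, h3⟩, hh.1.1⟩, hh.1.2⟩, hh.2⟩⟩
  have p0CnA : (prodBernoulli w0).real (evCnA a b c y) = (prodBernoulli w0).real CY := by
    refine measureReal_congr ?_
    filter_upwards [cb] with ω h1
    rw [hCY]
    exact propext ⟨fun hh => hh.1, fun hh => ⟨hh, h1⟩⟩
  have p0Pend : (prodBernoulli w0).real (evPend a b c y) = (prodBernoulli w0).real BCY := by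
    refine measureReal_congr ?_
    filter_upwards [cb, cc, cy'] with ω h1 h2 h3
    rw [hBCY]
    exact propext ⟨fun hh => ⟨hh.1.2, hh.2⟩, fun hh => ⟨⟨⟨⟨h1, h2⟩, h3⟩, hh.1⟩, hh.2⟩⟩
  have p0AC : (prodBernoulli w0).real (evAC a b c y) = 0 := real_eq_zero_of_subset w0 (fun ω hω => hω.1) hb0
  have p0AD : (prodBernoulli w0).real (evAD a b c y) = 0 := real_eq_zero_of_subset w0 (fun ω hω => hω.1.1) hb0
  have p0AB : (prodBernoulli w0).real (evAB a b c y) = 0 := real_eq_zero_of_subset w0 (fun ω hω => hω.1.1.1) hb0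
  have p0X : (prodBernoulli w0).real (evX a b c y) = 0 := by
    refine le_antisymm ?_ measureReal_nonneg
    calc (prodBernoulli w0).real (evX a b c y)
        ≤ (prodBernoulli w0).real (openConn a c ∪ openConn a y) :=
          measureReal_mono (fun ω hω => by
            rcases hω.2 with h | h
            · exact Or.inl h.1
            · exact Or.inr h.1) (measure_ne_top _ _)
      _ ≤ (prodBernoulli w0).real (openConn a c) + (prodBernoulli w0).real (openConn a y) :=
          measureReal_union_le _ _
      _ = 0 := by rw [hc0, hy0]; ring
  have p0Xp : (prodBernoulli w0).real (evXp a b c y) = 0 := by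
    refine le_antisymm ?_ measureReal_nonneg
    calc (prodBernoulli w0).real (evXp a b c y)
        ≤ (prodBernoulli w0).real (openConn a c ∪ openConn a y) :=
          measureReal_mono (fun ω hω => by
            rcases hω.2 with h | h
            · exact Or.inl h.1.1
            · exact Or.inr h.1.1) (measure_ne_top _ _)
      _ ≤ (prodBernoulli w0).real (openConn a c) + (prodBernoulli w0).real (openConn a y) :=
          measureReal_union_le _ _
      _ = 0 := by rw [hc0, hy0]; ring
  -- under `w1`: partition identities of the `{b,c,y}`-events by the position of `a`
  have R := fun (u v : Fin n) (ω : BondConfig (Fin n)) => (openGraph ω).Reachable u v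
  have p1Sep : (prodBernoulli w1).real Sep3 =
      (prodBernoulli w1).real (evEmp a b c y) + (prodBernoulli w1).real (evAB a b c y) +
        (prodBernoulli w1).real (evXp a b c y) := by
    have hdis1 : Disjoint (evEmp a b c y ∪ evAB a b c y) (evXp a b c y) := by
      rw [Set.disjoint_left]
      rintro ω (hω | hω) hω'
      · rcases hω'.2 with h | h
        · exact hω.1.1.1.1.2 h.1.1
        · exact hω.1.1.1.2 h.1.1
      · exact hω'.1 hω.1.1.1
    have hdis2 : Disjoint (evEmp a b c y) (evAB a b c y) := by
      rw [Set.disjoint_left]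
      intro ω hω hω'
      exact hω.1.1.1.1.1 hω'.1.1.1
    have hset : Sep3 = (evEmp a b c y ∪ evAB a b c y) ∪ evXp a b c y := by
      ext ω
      simp only [hSep3, evEmp, evAB, evXp, openConn, mem_inter_iff, mem_compl_iff, mem_union, mem_setOf_eq]
      constructor
      · rintro ⟨⟨hbc, hby⟩, hcy⟩
        by_cases hab : (openGraph ω).Reachable a b
        · -- a ~ b: then a ≁ c, a ≁ y
          refine Or.inl (Or.inr ⟨⟨⟨hab, fun hac => hbc (hab.symm.trans hac)⟩,
            fun hay => hby (hab.symm.trans hay)⟩, hcy⟩)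
        · by_cases hac : (openGraph ω).Reachable a c
          · exact Or.inr ⟨hab, Or.inl ⟨⟨hac, fun hay => hcy (hac.symm.trans hay)⟩, hby⟩⟩
          · by_cases hay : (openGraph ω).Reachable a y
            · exact Or.inr ⟨hab, Or.inr ⟨⟨hay, hac⟩, hbc⟩⟩
            · exact Or.inl (Or.inl ⟨⟨⟨⟨⟨hab, hac⟩, hay⟩, hbc⟩, hby⟩, hcy⟩)
      · rintro ((h | h) | h)
        · exact ⟨⟨h.1.1.2, h.1.2⟩, h.2⟩
        · obtain ⟨⟨⟨hab, hac⟩, hay⟩, hcy⟩ := h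
          exact ⟨⟨fun hbc => hac (hab.trans hbc), fun hby => hay (hab.trans hby)⟩, hcy⟩
        · obtain ⟨hab, h | h⟩ := h
          · obtain ⟨⟨hac, hay⟩, hby⟩ := h
            exact ⟨⟨fun hbc => hab (hac.trans hbc.symm), hby⟩, fun hcy => hay (hac.trans hcy)⟩
          · obtain ⟨⟨hay, hac⟩, hbc⟩ := h
            exact ⟨⟨hbc, fun hby => hab (hay.trans hby.symm)⟩, fun hcy => hac (hay.trans hcy.symm)⟩
    rw [hset, measureReal_union hdis1 MeasurableSet.of_discrete, measureReal_union hdis2 MeasurableSet.of_discrete]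
  have p1CY : (prodBernoulli w1).real CY =
      (prodBernoulli w1).real (evAC a b c y) + (prodBernoulli w1).real (evCnA a b c y) := by
    have hdis : Disjoint (evAC a b c y) (evCnA a b c y) := by
      rw [Set.disjoint_left]; intro ω hω hω'; exact hω'.2 hω.1
    have hset : CY = evAC a b c y ∪ evCnA a b c y := by
      ext ω
      simp only [hCY, evAC, evCnA, openConn, mem_inter_iff, mem_compl_iff, mem_union, mem_setOf_eq]
      constructor
      · intro hcy
        by_cases hab : (openGraph ω).Reachable a b
        · exact Or.inl ⟨hab, hcy⟩
        · exact Or.inr ⟨hcy, hab⟩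
      · rintro (h | h)
        · exact h.2
        · exact h.1
    rw [hset, measureReal_union hdis MeasurableSet.of_discrete]
  set ACc : Set (BondConfig (Fin n)) := evAC a b c y ∩ openConn a c with hACc
  have p1BCY : (prodBernoulli w1).real BCY =
      (prodBernoulli w1).real ACc + (prodBernoulli w1).real (evPend a b c y) := by
    have hdis : Disjoint ACc (evPend a b c y) := by
      rw [Set.disjoint_left]; intro ω hω hω'; exact hω'.1.1.1.1 hω.1.1
    have hset : BCY = ACc ∪ evPend a b c y := by
      ext ω
      simp only [hBCY, hACc, evAC, evPend, openConn, mem_inter_iff, mem_compl_iff, mem_union, mem_setOf_eq]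
      constructor
      · rintro ⟨hbc, hby⟩
        by_cases hab : (openGraph ω).Reachable a b
        · exact Or.inl ⟨⟨hab, hbc.symm.trans hby⟩, hab.trans hbc⟩
        · exact Or.inr ⟨⟨⟨⟨hab, fun hac => hab (hac.trans hbc.symm)⟩, fun hay => hab (hay.trans hby.symm)⟩,
            hbc⟩, hby⟩
      · rintro (h | h)
        · obtain ⟨⟨hab, hcy⟩, hac⟩ := h
          exact ⟨hab.symm.trans hac, (hab.symm.trans hac).trans hcy⟩
        · exact ⟨h.1.2, h.2⟩
    rw [hset, measureReal_union hdis MeasurableSet.of_discrete]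
  have hACc_le : (prodBernoulli w1).real ACc ≤ (prodBernoulli w1).real (evAC a b c y) :=
    measureReal_mono (fun ω hω => hω.1) (measure_ne_top _ _)
  -- the row at `w0` vanishes (frozen cluster)
  have hrow0 : bil w0 w0 a b c y = 0 := row_eq_zero_of_frozen w0 a b c y hfro0
  -- assemble
  have hX1 : 0 ≤ (prodBernoulli w1).real (evX a b c y) := measureReal_nonneg
  have hXp1 : 0 ≤ (prodBernoulli w1).real (evXp a b c y) := measureReal_nonneg
  have hAD1 : 0 ≤ (prodBernoulli w1).real (evAD a b c y) := measureReal_nonneg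
  unfold ndGap
  rw [← hw0, ← hw1]
  unfold bil at hrow0 ⊢
  rw [p0AC, p0AD, p0AB, p0X, p0Xp, p0Emp, p0CnA, p0Pend, ← eqSep, ← eqCY, ← eqBCY, p1Sep, p1CY, p1BCY]
  rw [p0AC, p0AD, p0AB, p0X, p0Xp, p0Emp, p0CnA, p0Pend] at hrow0
  nlinarith [mul_nonneg hAD1 hX1,
    mul_nonneg (sub_nonneg.2 hACc_le) hXp1, hrow0]

end Q44b

end Summit.CriticalPhenomena.PercolationContinuityZ3.Theorems

end
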